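import Literature.NumberTheory.GelbartRogawski1991.LocalSplittingCMGaloisConjRigidity
import HarnessLib

/-!
# Undoubling commutes with `g ↦ ḡ`; the UNDOUBLED CM splitting under Galois conjugation

Topic `NumberTheory/GelbartRogawski1991`; namespace `Literature.NumberTheory.GelbartRogawski1991.UnitaryDualPair.LocalSplitting` (home of ★ `inlLoc`,
`undoubleLoc`, `localSplittingCMWith`).  KERNEL ONLY: theorems; no definition, no named fact, no `sorry`.  Cell `hodgecm-mathlib` (D-0151), programme
P5 (crux HLiu418 = stmt-HodgeConjecture-24832), piece **P1u** of the road card `F0/P5/A-p18/g23/ROAD-L4if-v2.A-p18g23.md` §4 (A-p18 (g23), 2026-08-31):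
the UNDOUBLED form of ★ P1 `localSplittingDatumCM_comp_localPiGalConj_eq_scaleTransportSection` (p835306) — the statement «`s_χ^{T₀} ∘ bar =
scaleTransport_{−1}(s_{χ′}^{−T₀})`» about the tree's local splitting of record `localSplittingCMWith` of the undoubled group `U(T₀)(F_v)`.

THE MATHEMATICS ([GelbartRogawski1991, §3.1 Prop. 3.1.1 p. 455 L1–3]: restrict the doubled splitting along `g ↦ g ⊕ 1` and strip the second factor;
[MoeglinVignerasWaldspurger1987, Chap. 2 II.1 Rem. (6)]).
* §1 `bar^𝔻(g ⊕ 1) = ḡ ⊕ 1` (`localPiGalConj_inlLoc`): entrywise conjugation commutes with the block-diagonal embedding (`c ⊗ 1` fixes `0` and `1`).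
* §2 **undoubling commutes with `bar`** (`undoubleLoc_comp_localPiGalConj`): for a section `S` of the doubled group over `ι^𝔻_δ`, the undoubling (over
  `ι_{−δ}`, ★ `proj_comp_localPiGalConj`) of `S ∘ bar^𝔻` IS `(undoubleLoc S) ∘ bar` — same projections (`ι_{−δ}(g) = ι_δ(ḡ)`, ★ `iota_neg_eq_iota_galConj`)
  and same operators (`ω(S((ḡ) ⊕ 1))(f₁ ⊠ f₂) = ω(undoubleLoc S ḡ) f₁ ⊠ f₂`, ★ `toRep_undoubleLoc_boxSB`, `⊠`-cancellation ★ `boxSB_left_cancel`,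
  ★ `MpPsi.ext_of_proj_of_toRep`).
* §3 **`localSplittingCMWith_comp_localPiGalConj_eq_scaleTransportSection`**: at a NON-SPLIT `v`, for diagonal invertible `T₀`, `T₀′ = (−1)•T₀`,
  splitting Hecke characters `χ, χ′` with `(χ′_w)⁻¹ = (χ_w)⁻¹ ∘ σ_w`, and a mover of `ℓ_Δ` onto `ℓ_Y`:
  `(localSplittingCMWith L n hT₀ hT₀d hJ₀ χ hχ v μ) ∘ bar = scaleTransportSection_{−1}(localSplittingCMWith L n hT₀′ hT₀′d hJ₀′ χ′ hχ′ v μ)` — ★ P1 read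
  through §2 and ★ `scaleTransportSection_localSplittingCMWith` (`localSplittingCMWith = undoubleLoc` of the doubled CM datum, by definition).
  In the road's words: **`s_{λ,a} ∘ bar = s_{λᶜ,−a}`** in the common `(T₀, −δ)`-model — step (M1) at the level of SECTIONS, no leftover character.
Nothing of the cited sources is asserted; HC_CM is proved only modulo the printed citations until rung 0 closes.

## References
* [GelbartRogawski1991] S. Gelbart, J. Rogawski, Invent. Math. 105 (1991), §3.1 Prop. 3.1.1 p. 455 L1–3, Remark p. 457.
* [MoeglinVignerasWaldspurger1987] C. Mœglin, M.-F. Vignéras, J.-L. Waldspurger, LNM 1291 (1987), Chap. 2 II.1 (B) and Rem. (6).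
* [Kudla1994] S. Kudla, Israel J. Math. 87 (1994), §3 Thm. 3.1.
-/

set_option autoImplicit false
-- buildfix G11b-3 recipe (LEDGER B13-1/B13-3), as in the GelbartRogawski1991 siblings: elaborate sequentially.
set_option Elab.async false

noncomputable section

open scoped Matrix
open NumberField IsDedekindDomain MeasureTheory Matrix
open Literature.RepresentationTheory.HeisenbergGroup
open Literature.NumberTheory.Automorphic Literature.NumberTheory.Automorphic.UnitaryGroup Literature.NumberTheory.Weil1964
open Literature.NumberTheory.GaloisRepresentations Literature.RepresentationTheory.HarrisKudlaSweet1996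

namespace Literature.NumberTheory.GelbartRogawski1991.UnitaryDualPair.LocalSplitting

/-! ## §1 `bar^𝔻 (g ⊕ 1) = ḡ ⊕ 1` -/

section Inl

variable (F : Type) [Field F] [NumberField F] (E : Type) [Field E] [NumberField E] [Algebra F E] (c : E ≃ₐ[F] E)
  (v : HeightOneSpectrum (𝓞 F)) (n : ℕ) {T₀ : Matrix (Fin n) (Fin n) F}
  {J : Matrix (Fin n) (Fin n) E} (hJ : J = T₀.map (algebraMap F E))
  {JD : Matrix (Fin (n + n)) (Fin (n + n)) E} (hJD : JD = (gramD F n T₀).map (algebraMap F E))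

/-- **`bar^𝔻(g ⊕ 1) = ḡ ⊕ 1`**: entrywise `c ⊗ 1` on the doubled group commutes with `g ↦ g ⊕ 1` (★ `inlLoc`).
[cite: GelbartRogawski1991, §3.1 Prop. 3.1.1 p. 455 L1–3] -/
theorem localPiGalConj_inlLoc (g : UnitaryGroup.localPi E c n J v) :
    localPiGalConj E c (n + n) v hJD (inlLoc F E c v n hJ hJD g) = inlLoc F E c v n hJ hJD (localPiGalConj E c n v hJ g) := by
  apply (UnitaryGroup.localPiEquiv E c (n + n) JD v).injective
  rw [localPiEquiv_localPiGalConj, localPiEquiv_inlLoc, localPiEquiv_inlLoc]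
  refine Subtype.ext (Units.ext ?_)
  rw [val_localGalConj, coe_inlLocal, coe_inlLocal, UnitaryGroup.coe_reindexGL, UnitaryGroup.coe_reindexGL,
    UnitaryGroup.coe_blockDiagGL, UnitaryGroup.coe_blockDiagGL, localPiEquiv_localPiGalConj]
  rw [Matrix.reindex_apply, Matrix.reindex_apply, ← Matrix.submatrix_map, Matrix.fromBlocks_map, Matrix.map_zero _ (map_zero _),
    Units.val_one, Matrix.map_one _ (map_zero _) (map_one _)]
  rfl

end Inl

/-! ## §2 Undoubling commutes with `bar` -/

section Undouble

variable (F : Type) [Field F] [NumberField F] (E : Type) [Field E] [NumberField E] [Algebra F E]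
  [Algebra.IsQuadraticExtension F E] (c : E ≃ₐ[F] E)
  (v : HeightOneSpectrum (𝓞 F)) (n : ℕ) {T₀ : Matrix (Fin n) (Fin n) F}
  {J : Matrix (Fin n) (Fin n) E} (hJ : J = T₀.map (algebraMap F E))
  {JD : Matrix (Fin (n + n)) (Fin (n + n)) E} (hJD : JD = (gramD F n T₀).map (algebraMap F E))
  {δ : E} (hcδ : c δ = -δ) (hδ : δ ≠ 0) {d : F} (hd : δ * δ = algebraMap F E d)
  (hcδ' : c (-δ) = -(-δ)) (hδ' : -δ ≠ 0) (hd' : -δ * -δ = algebraMap F E d)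
  (hT₀ : T₀.IsSymm) (hT₀d : IsUnit T₀.det)
  (S : UnitaryGroup.localPi E c (n + n) JD v →* LocalMp F (n + n) (gramD F n T₀) v)
  (hS : ∀ g, MpPsi.proj _ (S g) = iota F E c (n + n) hcδ hδ hd (gramD F n T₀) (gramD_isSymm F n hT₀) hJD v g)

set_option synthInstance.maxHeartbeats 400000 in
set_option maxHeartbeats 2000000 in
/-- **Undoubling commutes with `g ↦ ḡ`.**  For a section `S` of the doubled group over `ι^𝔻_δ`, the undoubling over `ι_{−δ}` of `S ∘ bar^𝔻` (a section over
`ι^𝔻_{−δ}`, ★ `proj_comp_localPiGalConj`) IS `(undoubleLoc S) ∘ bar`: equal projections (`ι_{−δ}(g) = ι_δ(ḡ)`) and equal operators on `𝒮(F_vⁿ)`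
(`ω(S(ḡ ⊕ 1))(f₁ ⊠ 1_{𝒪ⁿ}) = ω(undoubleLoc S ḡ) f₁ ⊠ 1_{𝒪ⁿ}`, `⊠`-cancellation). [cite: GelbartRogawski1991, §3.1 Prop. 3.1.1 p. 455 L1–3]
[cite: MoeglinVignerasWaldspurger1987, Chap. 2 II.1 Rem. (6)] -/
theorem undoubleLoc_comp_localPiGalConj :
    undoubleLoc F E c v n hJ hJD hcδ' hδ' hd' hT₀ hT₀d (S.comp (localPiGalConj E c (n + n) v hJD))
        (proj_comp_localPiGalConj F E c (n + n) hcδ hδ hd hcδ' hδ' hd' (gramD F n T₀) (gramD_isSymm F n hT₀) hJD v S hS) =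
      (undoubleLoc F E c v n hJ hJD hcδ hδ hd hT₀ hT₀d S hS).comp (localPiGalConj E c n v hJ) := by
  have hne : unitVec F (Fin n) v ≠ 0 := fun h0 => by
    have h1 : ((unitVec F (Fin n) v : SchwartzBruhat (Fin n → v.adicCompletion F)) : (Fin n → v.adicCompletion F) → ℂ) 0 = 1 :=
      unitVec_apply_of_mem fun i _ => (v.adicCompletionIntegers F).zero_mem
    rw [h0, ZeroMemClass.coe_zero, Pi.zero_apply] at h1
    exact zero_ne_one h1
  refine MonoidHom.ext fun g => MpPsi.ext_of_proj_of_toRep ?_ fun f₁ => ?_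
  · rw [proj_undoubleLoc, MonoidHom.comp_apply, proj_undoubleLoc]
    exact iota_neg_eq_iota_galConj F E c n hcδ hδ hd hcδ' hδ' hd' T₀ hT₀ hJ v g
  · refine boxSB_left_cancel (v.adicCompletion F) (e₂ n) hne ?_
    rw [MonoidHom.comp_apply, ← toRep_undoubleLoc_boxSB, ← toRep_undoubleLoc_boxSB, MonoidHom.comp_apply, localPiGalConj_inlLoc]

/-- `undoubleLoc` does not depend on the NAME of the trace-zero element nor on the proof of the projection formula: equal `δ`'s and equal
sections give equal undoublings. [cite: GelbartRogawski1991, §3.1 Prop. 3.1.1 p. 455 L1–3] -/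
theorem undoubleLoc_congr_delta_section {δ₁ δ₂ : E} (hδ₁₂ : δ₁ = δ₂)
    (hc₁ : c δ₁ = -δ₁) (h0₁ : δ₁ ≠ 0) {d₁ : F} (hd₁ : δ₁ * δ₁ = algebraMap F E d₁)
    (hc₂ : c δ₂ = -δ₂) (h0₂ : δ₂ ≠ 0) {d₂ : F} (hd₂ : δ₂ * δ₂ = algebraMap F E d₂)
    {s s' : UnitaryGroup.localPi E c (n + n) JD v →* LocalMp F (n + n) (gramD F n T₀) v} (h : s = s')
    (hs₁ : ∀ g, MpPsi.proj _ (s g) = iota F E c (n + n) hc₁ h0₁ hd₁ (gramD F n T₀) (gramD_isSymm F n hT₀) hJD v g)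
    (hs₂ : ∀ g, MpPsi.proj _ (s' g) = iota F E c (n + n) hc₂ h0₂ hd₂ (gramD F n T₀) (gramD_isSymm F n hT₀) hJD v g) :
    undoubleLoc F E c v n hJ hJD hc₁ h0₁ hd₁ hT₀ hT₀d s hs₁ = undoubleLoc F E c v n hJ hJD hc₂ h0₂ hd₂ hT₀ hT₀d s' hs₂ := by
  subst hδ₁₂
  obtain rfl : d₁ = d₂ := (algebraMap F E).injective (hd₁.symm.trans hd₂)
  subst h
  rfl

end Undouble

/-! ## §3 The undoubled CM splitting under `bar` -/

section CM

variable (L : Type) [Field L] [NumberField L] [IsCMField L] (v : HeightOneSpectrum (𝓞 (maximalRealSubfield L)))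
  [MeasurableSpace (v.adicCompletion (maximalRealSubfield L))] [BorelSpace (v.adicCompletion (maximalRealSubfield L))]
  (μ : Measure (v.adicCompletion (maximalRealSubfield L))) [μ.IsAddHaarMeasure]
  (n : ℕ) {T₀ T₀' : Matrix (Fin n) (Fin n) (maximalRealSubfield L)} {J₀ J₀' : Matrix (Fin n) (Fin n) L}

/-- `−δ = (−1)⁻¹ · δ` for `δ = imagUnit L`. [folklore] -/
private theorem neg_imagUnit_eq_lineDelta' :
    -imagUnit L = algebraMap (maximalRealSubfield L) L (↑(-1 : (maximalRealSubfield L)ˣ)⁻¹ : maximalRealSubfield L) * imagUnit L := by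
  rw [inv_neg, inv_one, Units.val_neg, Units.val_one, map_neg, map_one, neg_one_mul]

set_option synthInstance.maxHeartbeats 400000 in
set_option maxHeartbeats 4000000 in
/-- **THE UNDOUBLED CM SPLITTING UNDER GALOIS CONJUGATION (non-split place).**  For diagonal invertible `T₀`, `T₀′ = (−1)•T₀`, splitting Hecke characters
`χ, χ′` with `(χ′_w)⁻¹ = (χ_w)⁻¹ ∘ σ_w` at the places over the non-split `v`, and any mover `m` of `ℓ_Δ` onto `ℓ_Y`:
`(localSplittingCMWith L n hT₀ hT₀d hJ₀ χ hχ v μ) ∘ bar = scaleTransportSection_{−1} (localSplittingCMWith L n hT₀′ hT₀′d hJ₀′ χ′ hχ′ v μ)` — the conjugate of the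
tree's local splitting of record of `U(T₀)(L⁺_v)` for `χ` IS the `(T₀, −δ)`-model transport of the splitting of record of `U(−T₀)(L⁺_v)` for `χ′`
(«`s_{λ,a} ∘ bar = s_{λᶜ,−a}`»). [cite: GelbartRogawski1991, §3.1 Prop. 3.1.1 p. 455 L1–3] [cite: Kudla1994, §3 Thm 3.1] -/
theorem localSplittingCMWith_comp_localPiGalConj_eq_scaleTransportSection (hn : 0 < n)
    (t : Fin n → maximalRealSubfield L) (hT₀t : T₀ = Matrix.diagonal t) (hT₀ : T₀.IsSymm) (hT₀d : IsUnit T₀.det)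
    (hT₀' : T₀'.IsSymm) (hT₀'d : IsUnit T₀'.det) (hTT₀ : T₀' = ((-1 : (maximalRealSubfield L)ˣ) : maximalRealSubfield L) • T₀)
    (hJ₀ : J₀ = T₀.map (algebraMap (maximalRealSubfield L) L)) (hJ₀' : J₀' = T₀'.map (algebraMap (maximalRealSubfield L) L))
    (hns : ∀ w : PlacesOver L v, IsCMField.complexConj L • w.1 = w.1)
    (χ χ' : HeckeCharacter L) (hχ : IsSplittingChar L 1 χ) (hχ' : IsSplittingChar L 1 χ')
    (hχχ' : ∀ (w : PlacesOver L v),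
      (χ'.localComponent w.1)⁻¹ = (χ.localComponent w.1)⁻¹.comp
        (Units.map (galAdicCompletionMap (L := L) (IsCMField.complexConj L) (hns w) : w.1.adicCompletion L →* w.1.adicCompletion L)))
    (m : LocalMp (maximalRealSubfield L) (n + n) (gramD (maximalRealSubfield L) n T₀) v)
    (hm : (deltaLagrangian (maximalRealSubfield L) v n).map (toLin (maximalRealSubfield L) v (MpPsi.proj _ m)) =
      lagrangianY (maximalRealSubfield L) (n + n) v) :
    (localSplittingCMWith L n hT₀ hT₀d hJ₀ χ hχ v μ).comp (localPiGalConj L (IsCMField.complexConj L) n v hJ₀) =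
      scaleTransportSection (maximalRealSubfield L) L (IsCMField.complexConj L) n (complexConj_imagUnit L) (imagUnit_ne_zero L)
        (imagUnit_mul_self L) T₀ T₀' hT₀ hT₀' (-1) hTT₀ hJ₀ hJ₀' v (localSplittingCMWith L n hT₀' hT₀'d hJ₀' χ' hχ' v μ)
        (proj_localSplittingCMWith L n hT₀' hT₀'d hJ₀' χ' hχ' v μ) := by
  have hcδ' : IsCMField.complexConj L (-imagUnit L) = -(-imagUnit L) := by rw [map_neg, complexConj_imagUnit]
  have hδ' : -imagUnit L ≠ 0 := neg_ne_zero.2 (imagUnit_ne_zero L)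
  have hd' : -imagUnit L * -imagUnit L = algebraMap (maximalRealSubfield L) L (imagUnitSq L) := by rw [neg_mul_neg, imagUnit_mul_self]
  -- the doubled identity (★ P1) and the scale-transport/undoubling identity (★)
  have hD := localSplittingDatumCM_comp_localPiGalConj_eq_scaleTransportSection L v μ n hn t hT₀t hT₀ hT₀d hT₀' hT₀'d hTT₀ hns χ χ'
    hχ hχ' hχχ' m hm
  rw [scaleTransportSection_localSplittingCMWith L v μ n (-1) hT₀ hT₀' hT₀d hT₀'d hTT₀ (gramD_of_eq_smul (maximalRealSubfield L) (-1) hTT₀)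
    hJ₀ hJ₀' χ' hχ']
  -- `localSplittingCMWith = undoubleLoc (doubled datum)` by definition; undoubling commutes with `bar` (§2)
  have hU := undoubleLoc_comp_localPiGalConj (maximalRealSubfield L) L (IsCMField.complexConj L) v n hJ₀ rfl (complexConj_imagUnit L)
    (imagUnit_ne_zero L) (imagUnit_mul_self L) hcδ' hδ' hd' hT₀ hT₀d (localSplittingDatumCM L v μ n hT₀ hT₀d rfl χ hχ).localSplitting
    (localSplittingDatumCM L v μ n hT₀ hT₀d rfl χ hχ).proj_localSplitting
  change (undoubleLoc (maximalRealSubfield L) L (IsCMField.complexConj L) v n hJ₀ rfl (complexConj_imagUnit L) (imagUnit_ne_zero L)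
      (imagUnit_mul_self L) hT₀ hT₀d (localSplittingDatumCM L v μ n hT₀ hT₀d rfl χ hχ).localSplitting
      (localSplittingDatumCM L v μ n hT₀ hT₀d rfl χ hχ).proj_localSplitting).comp (localPiGalConj L (IsCMField.complexConj L) n v hJ₀) = _
  rw [← hU]
  -- both sides are undoublings over `ι_{−δ}` ∕ `ι_{(−1)⁻¹δ}` of EQUAL doubled sections
  exact undoubleLoc_congr_delta_section (maximalRealSubfield L) L (IsCMField.complexConj L) v n hJ₀ rfl hT₀ hT₀d (neg_imagUnit_eq_lineDelta' L)
    hcδ' hδ' hd' (conj_lineDelta (complexConj_imagUnit L) (-1)) (lineDelta_ne_zero (imagUnit_ne_zero L) (-1))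
    (lineDelta_mul_self (imagUnit_mul_self L) (-1)) hD _ _

end CM

end Literature.NumberTheory.GelbartRogawski1991.UnitaryDualPair.LocalSplitting

end
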